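import Summits.BirchSwinnertonDyer.Rank1Residual.X11b.CastellaErratumTwist
import Summits.BirchSwinnertonDyer.Rank1Residual.Additive.TypeGIntegralJ
import Literature.NumberTheory.EllipticCurves.NeronComponentDataProofs
import Literature.NumberTheory.EllipticCurves.ComplexMultiplicationDeuringLocalPlaces
import Literature.NumberTheory.EllipticCurves.TamagawaRingEquivProofs
import Literature.NumberTheory.EllipticCurves.TamagawaSubgroupProofs
import Literature.NumberTheory.EllipticCurves.TamagawaPrimesEquivProofs
import Literature.NumberTheory.EllipticCurves.TamagawaFiniteIndexProofs
import Literature.NumberTheory.DiophantineGeometry.MinimalDiscriminantNormProofs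
import Literature.NumberTheory.DiophantineGeometry.MinimalDiscriminantProofs
import Literature.NumberTheory.DiophantineGeometry.TateAlgorithmProofs
import Mathlib.NumberTheory.RamificationInertia.Valuation
import HarnessLib

/-!
# X11b, route R1 — local Tamagawa numbers in a quadratic extension: the tree lemmas

HONEST FRAMING (cell `b2b-bsdres`, verbatim): the goal of the cell is to DELETE the
COMBINATION-SHAPED residual classes for ALL analytic-rank `≤ 1` curves over `ℚ` — "full BSD
formula for every rank `≤ 1` curve in class C" assembled STRICTLY from published theorems — so that
the rank-`≤ 1` remainder becomes exactly the CONSTRUCTION-SHAPED classes, which are TYPED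
(missing-input `Prop`s), NOT attempted. This is not "finishing BSD". Sub-cell `b2b-bsdres-multr1-p1`,
research route R1 for X11b (Castella 2018 Thm. A re-proved along the author's erratum). This file
and its sibling `TamagawaQuadraticBaseChange.lean` PROVE the bookkeeping link (C) of Castella §5 —
"the immediate relation `Σ_{w∣N} c_w(E/K) = Σ_{ℓ∣N} c_ℓ(E/ℚ) + Σ_{ℓ∣N} c_ℓ(E^D/ℚ)`" read
`p`-adically — for EVERY `E/ℚ` (no semistability), from tree theorems only: no named fact, no
`def`, nothing asserted. Here: the local lemmas.

* `valuation_j_eq_exp_ordMinimalDiscriminant` — at a place of multiplicative reduction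
  `|j|_v = q_v^{ord_v(Δ_min)}`, i.e. `ord_v(j) = −ord_v(Δ_min)` (Silverman *AEC* VII.5.1(b): a
  minimal equation has `v(c₄) = 0`, and `j·Δ = c₄³`), over any Dedekind domain; hence
  `one_lt_valuation_j`.
* `kodairaNeron_localTamagawaNumber` — **Kodaira–Néron at a finite place of a number field**:
  `1 ≤ c_w`, split multiplicative `⇒ c_w = ord_w(Δ_min)`, otherwise `c_w ≤ 4` (AEC Thm. VII.6.1;
  the tree's proof over `ℚ`, `kodairaNeron_tamagawaNumberAt`, verbatim at a place of `𝓞 K` — every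
  ingredient of it is stated over a Dedekind domain with finite residue field).
* `padicValNat_localTamagawaNumber_eq_zero` — the `p`-unit criterion used by Castella §5 / W. Zhang
  2014 / Kodaira–Néron: for `p ≥ 5`, if `ord_w(j) = −n < 0` only with `p ∤ n`, then `p ∤ c_w`.
* `localTamagawaNumber_baseChange_eq_of_degree_one` — at a place `w` of `K ⊇ F` with
  `e(w|v) = f(w|v) = 1`, `c_w(E_K) = c_v(E)` (the completions are isomorphic discretely valued
  fields; transport `localTamagawaNumber_map_ringEquiv`; same proof as the tree's
  `localEulerFactor_baseChange_eq_of_ramificationIdx_eq_one_of_inertiaDeg_eq_one`).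
* `localTamagawaNumber_eq_of_twist_of_isSquare` — `c_v(E^{(d)}) = c_v(E)` when `d ∈ (ℚ_v^×)²`
  (the twist is `ℚ_v`-isomorphic to `E`, `exists_baseChange_eq_smul_of_twist`; AEC X.5.4).
* `primesOver_span_eq_image_setOf_under_eq`, `ncard_primesOver_span_eq` — the primes of `𝓞 K`
  over `(ℓ) ⊂ ℤ` are the places of `K` above the place `v ↔ ℓ` of `ℚ` (bridge between the cell's
  `SplitsIn K ℓ` and the place-indexed trichotomy `placesOver_trichotomy_of_finrank_eq_two`).
-/

noncomputable section

open scoped Classical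

open WeierstrassCurve NumberField IsDedekindDomain Literature.NumberTheory.EllipticCurves
  Literature.NumberTheory.EllipticCurves.Rank1Residual

namespace Summit.BirchSwinnertonDyer.Rank1Residual.X11b

section LocalJ

variable {A : Type*} [CommRing A] [IsDedekindDomain A] {K : Type*} [Field K] [Algebra A K]
  [IsFractionRing A K] (v : HeightOneSpectrum A) (X : WeierstrassCurve K) [X.IsElliptic]

/-- **`ord_v(j) = −ord_v(Δ_min)` at a place of multiplicative reduction** (Silverman, *AEC*
Prop. VII.5.1(b): the minimal equation at `v` has `v(c₄) = 0 < v(Δ)`, and `j · Δ = c₄³`), as the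
exact identity `|j(X)|_v = exp(ord_v(Δ_min))` in `ℤᵐ⁰`, over the fraction field `K` of any Dedekind
domain; the reduction type is that of the chosen minimal model `X.localMinimalModel v`, `j` is read
in `K`. [cite: SilvermanAEC2009, Prop. VII.5.1(b)] -/
theorem valuation_j_eq_exp_ordMinimalDiscriminant (h : X.HasMultiplicativeReductionAt v) :
    v.valuation K X.j = WithZero.exp (X.ordMinimalDiscriminant v : ℤ) := by
  set Ov := v.adicCompletionIntegers K
  set Kv := v.adicCompletion K
  haveI : (X.localMinimalModel v).IsElliptic := X.isElliptic_localMinimalModel v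
  obtain ⟨-, hc₄m⟩ := (X.hasMultiplicativeReductionAt_iff_mem v).mp h
  have hj' : (X.localMinimalModel v).j = algebraMap K Kv X.j := by
    show ((((X.baseChange Kv).exists_isMinimal Ov).choose) • X.baseChange Kv).j = _
    rw [variableChange_j]
    exact X.map_j _
  have hI : (X.localMinimalIntegralModel v).baseChange Kv = X.localMinimalModel v :=
    baseChange_integralModel_eq Ov _
  have key : (X.localMinimalModel v).j * (X.localMinimalModel v).Δ =
      (X.localMinimalModel v).c₄ ^ 3 := by
    rw [WeierstrassCurve.j, ← coe_Δ', mul_comm, ← mul_assoc, Units.mul_inv, one_mul]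
  have hΔI : (X.localMinimalModel v).Δ = algebraMap Ov Kv (X.localMinimalIntegralModel v).Δ := by
    rw [← hI]; exact (X.localMinimalIntegralModel v).map_Δ _
  have hc₄I : (X.localMinimalModel v).c₄ = algebraMap Ov Kv (X.localMinimalIntegralModel v).c₄ := by
    rw [← hI]; exact (X.localMinimalIntegralModel v).map_c₄ _
  have hΔ0 : (X.localMinimalIntegralModel v).Δ ≠ 0 := by
    intro h0
    have : (X.localMinimalModel v).Δ = 0 := by rw [hΔI, h0, map_zero]
    exact (X.localMinimalModel v).isUnit_Δ.ne_zero this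
  obtain ⟨n, hn, hvn⟩ := HeightOneSpectrum.exists_addVal_adicCompletionIntegers_eq K v _ hΔ0
  have hord : X.ordMinimalDiscriminant v = n := by
    rw [ordMinimalDiscriminant, hn]; rfl
  have hc₄v : Valued.v (algebraMap Ov Kv (X.localMinimalIntegralModel v).c₄) = 1 := by
    have hu : IsUnit (X.localMinimalIntegralModel v).c₄ := by
      by_contra hu
      exact hc₄m ((IsLocalRing.mem_maximalIdeal _).mpr hu)
    exact HeightOneSpectrum.adicCompletionIntegers.isUnit_iff_valued_eq_one.mp hu
  have hval := congrArg (Valued.v : Valuation Kv (WithZero (Multiplicative ℤ))) key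
  rw [map_mul, map_pow, hc₄I, hc₄v, one_pow, hΔI] at hval
  have hΔv : Valued.v (algebraMap Ov Kv (X.localMinimalIntegralModel v).Δ) =
      WithZero.exp (-(n : ℤ)) := hvn
  rw [hΔv] at hval
  have hjv : Valued.v ((X.localMinimalModel v).j) = WithZero.exp (n : ℤ) := by
    have hne : WithZero.exp (-(n : ℤ)) ≠ 0 := WithZero.exp_ne_zero
    rw [eq_comm, ← div_eq_iff hne, one_div, ← WithZero.exp_neg, neg_neg] at hval
    exact hval.symm
  rw [hord, ← HeightOneSpectrum.valuedAdicCompletion_eq_valuation' v X.j, ← hjv, hj']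
  rfl

/-- `ord_v(Δ_min) > 0` at a place of multiplicative (hence bad) reduction
(`ordMinimalDiscriminant_eq_zero_iff`: it vanishes exactly at good places). [folklore] -/
theorem ordMinimalDiscriminant_pos_of_hasMultiplicativeReductionAt
    (h : X.HasMultiplicativeReductionAt v) : 0 < X.ordMinimalDiscriminant v := by
  rw [Nat.pos_iff_ne_zero, Ne, X.ordMinimalDiscriminant_eq_zero_iff_holds v]
  exact h.not_hasGoodReductionAt

/-- **`|j|_v > 1` (i.e. `ord_v(j) < 0`) at a place of multiplicative reduction**
(Silverman, *AEC* Prop. VII.5.1(b)). [cite: SilvermanAEC2009, Prop. VII.5.1(b)] -/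
theorem one_lt_valuation_j (h : X.HasMultiplicativeReductionAt v) : 1 < v.valuation K X.j := by
  rw [valuation_j_eq_exp_ordMinimalDiscriminant v X h, ← WithZero.exp_zero, WithZero.exp_lt_exp]
  exact_mod_cast ordMinimalDiscriminant_pos_of_hasMultiplicativeReductionAt v X h

end LocalJ

section KodairaNeron

variable {K : Type*} [Field K] [NumberField K] (X : WeierstrassCurve K) [X.IsElliptic]
  (w : HeightOneSpectrum (𝓞 K))

/-- **Kodaira–Néron at a finite place of a number field** (Silverman, *AEC* Thm. VII.6.1; *ATAEC*
Cor. IV.9.2(d), Thm. IV.9.4 and Table 4.1): for an elliptic curve `X/K` and a finite place `w`,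
the local Tamagawa number `c_w = [E(K_w) : E₀(K_w)]` satisfies `1 ≤ c_w`; `c_w = ord_w(Δ_min)` if
the reduction is split multiplicative; and `c_w ≤ 4` otherwise. Proof = the tree's proof over `ℚ`
(`kodairaNeron_tamagawaNumberAt`) at a place of `𝓞 K`: finiteness (`localTamagawaNumber_baseChange_ne_zero`),
the split case (`localTamagawaNumber_eq_ordMinimalDiscriminant_of_hasSplitMultiplicativeReductionAt`),
and otherwise the case analysis on the Kodaira symbol `X.kodairaSymbolAt w` of Tate's algorithm,
each type discharged by the corresponding local-index theorem of the `NeronComponentIndex*Proofs`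
files (all stated over a Dedekind domain with finite / perfect residue field).
[cite: SilvermanAEC2009, Thm VII.6.1] -/
theorem kodairaNeron_localTamagawaNumber :
    1 ≤ (X.baseChange (w.adicCompletion K)).localTamagawaNumber (w.adicCompletionIntegers K) ∧
      (X.HasSplitMultiplicativeReductionAt w →
        (X.baseChange (w.adicCompletion K)).localTamagawaNumber (w.adicCompletionIntegers K) =
          X.ordMinimalDiscriminant w) ∧
      (¬ X.HasSplitMultiplicativeReductionAt w →
        (X.baseChange (w.adicCompletion K)).localTamagawaNumber (w.adicCompletionIntegers K) ≤ 4) := by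
  haveI : Finite (IsLocalRing.ResidueField (w.adicCompletionIntegers K)) :=
    HeightOneSpectrum.finite_residueField_adicCompletionIntegers K w
  haveI : PerfectField (IsLocalRing.ResidueField (w.adicCompletionIntegers K)) :=
    PerfectField.ofFinite
  haveI := X.isElliptic_localMinimalModel w
  refine ⟨Nat.one_le_iff_ne_zero.mpr (X.localTamagawaNumber_baseChange_ne_zero w),
    fun hs => localTamagawaNumber_eq_ordMinimalDiscriminant_of_hasSplitMultiplicativeReductionAt
      w X hs,
    fun hns => ?_⟩
  rcases hk : X.kodairaSymbolAt w with (_ | m) | _ | _ | _ | (_ | n) | _ | _ | _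
  · -- `I₀`: good reduction, `c_w = 1`
    have hg : X.HasGoodReductionAt w :=
      (WeierstrassCurve.isGood_kodairaSymbolAt_iff_holds w X).mp hk
    rw [localTamagawaNumber_eq_one_of_good' w X
      (WeierstrassCurve.localTamagawaNumber_eq_one_of_hasGoodReduction_holds _ _) hg]
    norm_num
  · -- `Iₘ₊₁`: multiplicative, non-split by hypothesis, `c_w ∈ {1, 2}`
    obtain ⟨hmult, -⟩ :=
      (WeierstrassCurve.kodairaSymbolAt_eq_I_iff_holds w X m.succ_ne_zero).mp hk
    rw [localTamagawaNumber_of_hasNonsplitMultiplicativeReductionAt_holds w X hmult hns]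
    split_ifs <;> norm_num
  · -- `II`
    rw [localTamagawaNumber_eq_one_of_kodairaSymbolAt_eq_II_holds w X hk]
    norm_num
  · -- `III`
    rw [localTamagawaNumber_eq_two_of_kodairaSymbolAt_eq_III_holds w X hk]
    norm_num
  · -- `IV`
    rcases localTamagawaNumber_of_kodairaSymbolAt_eq_IV_holds w X hk with h | h <;> omega
  · -- `I₀*`
    rcases localTamagawaNumber_of_kodairaSymbolAt_eq_Istar_zero_holds w X hk with h | h | h <;>
      omega
  · -- `Iₙ₊₁*`
    rcases localTamagawaNumber_of_kodairaSymbolAt_eq_Istar_succ_holds w X n hk with h | h <;>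
      omega
  · -- `IV*`
    rcases localTamagawaNumber_of_kodairaSymbolAt_eq_IVstar_holds w X hk with h | h <;> omega
  · -- `III*`
    rw [localTamagawaNumber_eq_two_of_kodairaSymbolAt_eq_IIIstar_holds w X hk]
    norm_num
  · -- `II*`
    rw [localTamagawaNumber_eq_one_of_kodairaSymbolAt_eq_IIstar_holds w X hk]
    norm_num

/-- **The `p`-unit criterion for `c_w`, `p ≥ 5`** (the use of Kodaira–Néron in Castella 2018 §5,
CGLS 2022 (5.6), W. Zhang 2014: "`E[p]` ramified at a multiplicative `q` ⇒ `p ∤ c_q`", and `c ≤ 4`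
at additive places): if every positive `n` with `|j(X)|_w = exp(n)` (i.e. `ord_w(j) = −n < 0`) is
prime to `p`, then `p ∤ c_w`. For split multiplicative reduction `c_w = ord_w(Δ_min) = −ord_w(j)`
(`kodairaNeron_localTamagawaNumber`, `valuation_j_eq_exp_ordMinimalDiscriminant`); otherwise
`1 ≤ c_w ≤ 4 < p`. [cite: SilvermanAEC2009, Thm VII.6.1] -/
theorem padicValNat_localTamagawaNumber_eq_zero {p : ℕ} [Fact p.Prime] (hp : 5 ≤ p)
    (hj : ∀ n : ℕ, 0 < n → w.valuation K X.j = WithZero.exp (n : ℤ) → ¬ p ∣ n) :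
    padicValNat p
      ((X.baseChange (w.adicCompletion K)).localTamagawaNumber (w.adicCompletionIntegers K)) = 0 := by
  obtain ⟨h1, hsplit, hns⟩ := kodairaNeron_localTamagawaNumber X w
  refine padicValNat.eq_zero_of_not_dvd fun hdvd => ?_
  by_cases hs : X.HasSplitMultiplicativeReductionAt w
  · have hmult := hs.hasMultiplicativeReductionAt
    rw [hsplit hs] at hdvd
    exact hj _ (ordMinimalDiscriminant_pos_of_hasMultiplicativeReductionAt w X hmult)
      (valuation_j_eq_exp_ordMinimalDiscriminant w X hmult) hdvd
  · have h4 := hns hs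
    have hle := Nat.le_of_dvd (by omega) hdvd
    omega

end KodairaNeron

section SplitTransport

/-- **At a place of degree one the local Tamagawa number of the base change is the one below.**
For number fields `K ⊇ F`, an elliptic curve `X/F` and a finite place `w` of `K` with
`e(w|v) = f(w|v) = 1` over `v = w ∩ 𝓞 F`: `c_w(X_K) = c_v(X)`. The completions are isomorphic as
discretely valued fields compatibly with `F → K`
(`exists_ringEquiv_adicCompletion_of_ramificationIdx_eq_one_of_inertiaDeg_eq_one`), `X_K ⊗ K_w`
is the image of `X ⊗ F_v`, and `c` is invariant under such isomorphisms
(`localTamagawaNumber_map_ringEquiv`; Silverman *AEC* VII.6 Ex. 7.6). For quadratic `K/ℚ` this is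
"`c_w = c_w̄ = c_ℓ(E)` at a split `ℓ`" of Castella §5 / CGLS 2022 (5.6). [folklore] -/
theorem localTamagawaNumber_baseChange_eq_of_degree_one
    {F K : Type*} [Field F] [NumberField F] [Field K] [NumberField K] [Algebra F K]
    (X : WeierstrassCurve F) [X.IsElliptic] (w : HeightOneSpectrum (𝓞 K))
    (he : w.asIdeal.ramificationIdx (𝓞 F) = 1) (hf : w.asIdeal.inertiaDeg (𝓞 F) = 1) :
    ((X.baseChange K).baseChange (w.adicCompletion K)).localTamagawaNumber
        (w.adicCompletionIntegers K) =
      (X.baseChange ((w.under (𝓞 F)).adicCompletion F)).localTamagawaNumber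
        ((w.under (𝓞 F)).adicCompletionIntegers F) := by
  set v : HeightOneSpectrum (𝓞 F) := w.under (𝓞 F) with hv
  haveI : w.asIdeal.LiesOver v.asIdeal := ⟨rfl⟩
  obtain ⟨ψ, φ, hc, hφ⟩ := Literature.NumberTheory.Automorphic.exists_ringEquiv_adicCompletion_of_ramificationIdx_eq_one_of_inertiaDeg_eq_one
    F K v w he hf
  have hX : (X.baseChange K).baseChange (w.adicCompletion K) =
      (X.baseChange (v.adicCompletion F)).map (φ : v.adicCompletion F →+* w.adicCompletion K) := by
    simp only [baseChange, map_map]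
    congr 1
    refine RingHom.ext fun x ↦ ?_
    simp only [RingHom.coe_comp, Function.comp_apply, RingHom.coe_coe]
    exact (hφ x).symm
  haveI : (X.baseChange (v.adicCompletion F)).IsElliptic := by rw [baseChange]; infer_instance
  rw [hX, localTamagawaNumber_map_ringEquiv ψ φ hc]

/-- **Twisting by a `v`-adic square does not change `c_v`** (Silverman, *AEC* X.5 Cor. 5.4 with
VII.6 Ex. 7.6): if `d ∈ (ℚ_ℓ^×)²` for the prime `ℓ` under the place `v` of `ℚ` and
`C • W^{(d)} = Wd`, then `c_v(Wd) = c_v(W)` — both factors are the `ℚ_[ℓ]`-ones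
(`localTamagawaNumber_padic_eq_holds`), `Wd ⊗ ℚ_ℓ = D • (W ⊗ ℚ_ℓ)`
(`exists_baseChange_eq_smul_of_twist`), and `c` is invariant under changes of variables
(`localTamagawaNumber_variableChange_holds`). [folklore] -/
theorem localTamagawaNumber_eq_of_twist_of_isSquare (W : WeierstrassCurve ℚ) [W.IsElliptic]
    (v : HeightOneSpectrum (𝓞 ℚ)) {ℓ : ℕ} [Fact ℓ.Prime]
    (hv : (Rat.HeightOneSpectrum.primesEquiv v : ℕ) = ℓ) {d : ℚ} (hd : d ≠ 0)
    (hsq : IsSquare ((d : ℚ) : ℚ_[ℓ]))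
    (Wd : WeierstrassCurve ℚ) [Wd.IsElliptic] {C : VariableChange ℚ}
    (hC : C • W.quadraticTwist d = Wd) :
    (Wd.baseChange (v.adicCompletion ℚ)).localTamagawaNumber (v.adicCompletionIntegers ℚ) =
      (W.baseChange (v.adicCompletion ℚ)).localTamagawaNumber (v.adicCompletionIntegers ℚ) := by
  obtain ⟨D, hD⟩ := exists_baseChange_eq_smul_of_twist W hd hsq Wd hC
  haveI : (W.baseChange ℚ_[ℓ]).IsElliptic := inferInstanceAs (W.map (algebraMap ℚ ℚ_[ℓ])).IsElliptic
  rw [← localTamagawaNumber_padic_eq_holds W v ℓ hv, ← localTamagawaNumber_padic_eq_holds Wd v ℓ hv,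
    hD]
  exact localTamagawaNumber_variableChange_holds (R := ℤ_[ℓ]) (W.baseChange ℚ_[ℓ]) D

end SplitTransport

section Places

variable (K : Type*) [Field K] [NumberField K]

omit [NumberField K] in
/-- A prime `𝔭 ∋ ℓ` of `𝓞 K` lies over `(ℓ) ⊂ ℤ`. [folklore] -/
private theorem under_int_eq_span_of_mem {ℓ : ℕ} (hℓ : ℓ.Prime) (w : HeightOneSpectrum (𝓞 K))
    (hw : ((ℓ : ℤ) : 𝓞 K) ∈ w.asIdeal) : w.asIdeal.under ℤ = Ideal.span {(ℓ : ℤ)} := by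
  have hpprime : (Ideal.span {(ℓ : ℤ)}).IsPrime :=
    (Ideal.span_singleton_prime (by exact_mod_cast hℓ.ne_zero)).mpr (Nat.prime_iff_prime_int.mp hℓ)
  have hp0 : Ideal.span {(ℓ : ℤ)} ≠ ⊥ := by
    rw [Ne, Ideal.span_singleton_eq_bot]; exact_mod_cast hℓ.ne_zero
  haveI hpmax : (Ideal.span {(ℓ : ℤ)}).IsMaximal := hpprime.isMaximal hp0
  haveI := w.isPrime
  refine (hpmax.eq_of_le (Ideal.IsPrime.under ℤ w.asIdeal).ne_top fun x hx => ?_).symm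
  rw [Ideal.mem_span_singleton] at hx
  obtain ⟨c, rfl⟩ := hx
  rw [Ideal.mem_comap, map_mul, eq_intCast, eq_intCast]
  exact Ideal.mul_mem_right _ _ hw

/-- **The primes of `𝓞 K` over `(ℓ) ⊂ ℤ` are the places of `K` above the place `v ↔ ℓ` of `ℚ`**
(bridge between the `ℤ`-indexed `Ideal.primesOver` of the cell's `SplitsIn K ℓ` / Cai–Shu–Tian's
Heegner condition and the `𝓞 ℚ`-place-indexed fibres `{w | w ∩ 𝓞 ℚ = v}` of
`placesOver_trichotomy_of_finrank_eq_two`). [folklore] -/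
theorem primesOver_span_eq_image_setOf_under_eq (v : HeightOneSpectrum (𝓞 ℚ)) :
    (Ideal.span {((Rat.HeightOneSpectrum.primesEquiv v : ℕ) : ℤ)}).primesOver (𝓞 K) =
      HeightOneSpectrum.asIdeal '' {w : HeightOneSpectrum (𝓞 K) | w.under (𝓞 ℚ) = v} := by
  set ℓ : ℕ := (Rat.HeightOneSpectrum.primesEquiv v : ℕ) with hℓdef
  have hℓ : ℓ.Prime := (Rat.HeightOneSpectrum.primesEquiv v).2
  have hv : v = (Rat.HeightOneSpectrum.primesEquiv (R := 𝓞 ℚ)).symm ⟨ℓ, hℓ⟩ := by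
    rw [Equiv.eq_symm_apply]; exact Subtype.ext rfl
  have hℓv : (ℓ : 𝓞 ℚ) ∈ v.asIdeal :=
    (natCast_mem_asIdeal_iff_eq_primesEquiv_symm v hℓ).mpr hv
  have hp0 : Ideal.span {(ℓ : ℤ)} ≠ ⊥ := by
    rw [Ne, Ideal.span_singleton_eq_bot]; exact_mod_cast hℓ.ne_zero
  ext Q
  simp only [Set.mem_image, Set.mem_setOf_eq]
  constructor
  · intro hQ
    haveI := hQ.1
    haveI := hQ.2
    have hQ0 : Q ≠ ⊥ := Ideal.ne_bot_of_liesOver_of_ne_bot hp0 Q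
    set w : HeightOneSpectrum (𝓞 K) := ⟨Q, hQ.1, hQ0⟩
    refine ⟨w, ?_, rfl⟩
    have hℓQ : ((ℓ : ℤ) : 𝓞 K) ∈ Q := by
      have : (ℓ : ℤ) ∈ Q.under ℤ := by
        rw [← Ideal.LiesOver.over (p := Ideal.span {(ℓ : ℤ)}) (P := Q)]
        exact Ideal.mem_span_singleton_self _
      rw [Ideal.mem_comap, eq_intCast] at this
      exact this
    have hmem : (ℓ : 𝓞 ℚ) ∈ (w.under (𝓞 ℚ)).asIdeal := by
      rw [HeightOneSpectrum.under_asIdeal, Ideal.under_def, Ideal.mem_comap, map_natCast]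
      exact_mod_cast hℓQ
    rw [(natCast_mem_asIdeal_iff_eq_primesEquiv_symm _ hℓ).mp hmem, hv]
  · rintro ⟨w, hw, rfl⟩
    refine ⟨w.isPrime, ⟨?_⟩⟩
    have hmem : (ℓ : 𝓞 ℚ) ∈ (w.under (𝓞 ℚ)).asIdeal := by rw [hw]; exact hℓv
    rw [HeightOneSpectrum.under_asIdeal, Ideal.under_def, Ideal.mem_comap, map_natCast] at hmem
    exact (under_int_eq_span_of_mem K hℓ w (by exact_mod_cast hmem)).symm

/-- The number of primes of `𝓞 K` over `(ℓ)` is the number of places of `K` above `v ↔ ℓ`.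
[folklore] -/
theorem ncard_primesOver_span_eq (v : HeightOneSpectrum (𝓞 ℚ)) :
    ((Ideal.span {((Rat.HeightOneSpectrum.primesEquiv v : ℕ) : ℤ)}).primesOver (𝓞 K)).ncard =
      {w : HeightOneSpectrum (𝓞 K) | w.under (𝓞 ℚ) = v}.ncard := by
  rw [primesOver_span_eq_image_setOf_under_eq K v,
    Set.ncard_image_of_injective _ fun a b h => HeightOneSpectrum.ext h]

end Places


end Summit.BirchSwinnertonDyer.Rank1Residual.X11b

end
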